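import Mathlib.NumberTheory.ModularForms.JacobiTheta.TwoVariable
import Mathlib.Analysis.Analytic.OfScalars
import Mathlib.Analysis.Analytic.Uniqueness
import Mathlib.Analysis.SpecialFunctions.Exponential
import Mathlib.Analysis.Complex.Exponential
import Mathlib.Analysis.Normed.Module.FiniteDimension
import Literature.NumberTheory.LFunctions.GaussianThetaSeries
import HarnessLib

/-!
# Hecke's theta series of `ℤ[i]` with harmonic weights `z^k` and their transformation formula

Topic `Literature/NumberTheory/LFunctions` (next to `GaussianThetaSeries.lean`, weight one, and
`GaussianPrimesInSectors.lean`, where the Hecke angular characters `λ^m(z) = (z/|z|)^{4m}` of `ℤ[i]`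
live).  First analytic brick of the proof of Hecke's theorem on Gaussian primes in sectors
(`Literature.NumberTheory.LFunctions.GaussianInt.hecke_gaussianPrimes_inSectors`): for `k : ℕ` and
`t > 0` put

  `θ_k(t) = ∑_{z ∈ ℤ[i]} z^k e^{-π t N(z)}`      (`Literature.NumberTheory.LFunctions.GaussianHecke.theta`).

We PROVE the **theta transformation formula**

  `θ_k(1/t) = i^k t^{k+1} θ_k(t)`               (`theta_one_div`),

in particular `θ_{4m}(1/t) = t^{4m+1} θ_{4m}(t)` (`theta_four_mul_one_div`), the identity behind the
analytic continuation of Hecke's `L`-functions `L(s, λ^m) = ¼ ∑_{z ≠ 0} (z/|z|)^{4m} N(z)^{-s}` of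
`ℚ(i)` (Hecke 1920, §9; the continuation itself is carried out in the sequel
`GaussianHeckeThetaMellin.lean`).  Everything here is proved; no named facts are introduced.

## The proof (generating function and Jacobi's transformation formula)

Classically the formula is two-dimensional Poisson summation applied to the harmonic polynomial
`z^k` times a Gaussian.  We avoid two-dimensional Fourier analysis: for `t > 0` the generating
function

  `G_t(w) = ∑_{z ∈ ℤ[i]} e^{-π t N(z)} e^{2πi w z} = ϑ(w, it) · ϑ(iw, it)`     (`hasSum_genFun`)

is a product of two of Mathlib's two-variable Jacobi theta functions (`jacobiTheta₂`), and
Jacobi's transformation formula (`jacobiTheta₂_functional_equation`) gives EXACTLY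

  `G_t(w) = t⁻¹ G_{1/t}(-iw/t)`                                          (`genFun_functional_equation`)

(the two Gaussian prefactors `e^{∓π w²/t}` cancel: this is the harmonicity of `z ↦ (wz)^k`).  Both
sides are entire power series in `w`; the coefficient of `w^k` on the left is
`(2πi)^k/k! · θ_k(t)` (`hasFPowerSeriesOnBall_genFun`), on the right `t⁻¹ (-i/t)^k` times the same
at `1/t`, and power-series coefficients are unique (`HasFPowerSeriesAt.eq_formalMultilinearSeries`).

## References

* E. Hecke, *Eine neue Art von Zetafunktionen und ihre Beziehungen zur Verteilung der
  Primzahlen. II*, Math. Z. 6 (1920), 11–51, §9 (theta series of an imaginary quadratic field with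
  Grössencharakteren). [HeckeMathZ1920]
-/

noncomputable section

open Complex Real Filter Topology
open scoped Nat

namespace Literature.NumberTheory.LFunctions

namespace GaussianHecke

local notation "ℤ[i]" => GaussianInt

/-! ### Gaussian integers: casts and elementary bounds -/

/-- The bijection `ℤ × ℤ ≃ ℤ[i]`, `(a, b) ↦ a + bi`. [folklore] -/
def pairEquiv : ℤ × ℤ ≃ ℤ[i] where
  toFun p := ⟨p.1, p.2⟩
  invFun x := (x.re, x.im)
  left_inv _ := rfl
  right_inv _ := rfl

/-- `N(a + bi) = a² + b²` in `ℝ`. [folklore] -/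
theorem norm_cast_real (x : ℤ[i]) : ((x.norm : ℝ)) = (x.re : ℝ) ^ 2 + (x.im : ℝ) ^ 2 := by
  simp only [Zsqrtd.norm_def]; push_cast; ring

/-- `|a + bi| ≤ |a| + |b|`. [folklore] -/
theorem norm_toComplex_le (x : ℤ[i]) : ‖(x : ℂ)‖ ≤ |(x.re : ℝ)| + |(x.im : ℝ)| := by
  rw [GaussianInt.toComplex_def]
  refine (norm_add_le _ _).trans ?_
  rw [norm_mul, Complex.norm_I, mul_one, Complex.norm_intCast, Complex.norm_intCast]

/-- `‖e^{-π t N(x)}‖ = e^{-π t N(x)}` (the Gaussian factor is a positive real). [folklore] -/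
theorem norm_ofReal_exp (u : ℝ) : ‖((rexp u : ℝ) : ℂ)‖ = rexp u := by
  rw [Complex.norm_real, Real.norm_eq_abs, abs_of_pos (Real.exp_pos _)]

/-- The basic majorant: `e^{-π t N(x)} e^{2π S |x|} ≤ e^{-π(t a² - 2S|a|)} e^{-π(t b² - 2S|b|)}` for
`x = a + bi`, `S ≥ 0` (since `|x| ≤ |a| + |b|`). [folklore] -/
theorem exp_mul_exp_le {t S : ℝ} (hS : 0 ≤ S) (x : ℤ[i]) :
    rexp (-π * t * (x.norm : ℝ)) * rexp (2 * π * S * ‖(x : ℂ)‖) ≤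
      rexp (-π * (t * (x.re : ℝ) ^ 2 - 2 * S * |(x.re : ℝ)|)) *
        rexp (-π * (t * (x.im : ℝ) ^ 2 - 2 * S * |(x.im : ℝ)|)) := by
  rw [← Real.exp_add, ← Real.exp_add, Real.exp_le_exp, norm_cast_real]
  have h := mul_le_mul_of_nonneg_left (norm_toComplex_le x) (by positivity : 0 ≤ 2 * π * S)
  nlinarith [h]

/-- The majorant is summable over `ℤ[i]` for `t > 0` (product of two of Mathlib's one-dimensional
bounds `summable_pow_mul_jacobiTheta₂_term_bound`). [folklore] -/
theorem summable_expBound {t : ℝ} (ht : 0 < t) (S : ℝ) :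
    Summable fun x : ℤ[i] ↦ rexp (-π * (t * (x.re : ℝ) ^ 2 - 2 * S * |(x.re : ℝ)|)) *
      rexp (-π * (t * (x.im : ℝ) ^ 2 - 2 * S * |(x.im : ℝ)|)) := by
  have h1 : Summable fun n : ℤ ↦ rexp (-π * (t * (n : ℝ) ^ 2 - 2 * S * |(n : ℝ)|)) := by
    simpa using summable_pow_mul_jacobiTheta₂_term_bound S ht 0
  have h2 : Summable fun p : ℤ × ℤ ↦ rexp (-π * (t * (p.1 : ℝ) ^ 2 - 2 * S * |(p.1 : ℝ)|)) *
      rexp (-π * (t * (p.2 : ℝ) ^ 2 - 2 * S * |(p.2 : ℝ)|)) :=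
    summable_mul_of_summable_norm h1.norm h1.norm
  refine pairEquiv.summable_iff.1 ?_
  exact h2

/-- `∑_{x ∈ ℤ[i]} e^{-π t N(x)} e^{2π S |x|} < ∞` for `t > 0`, `S ≥ 0`. [folklore] -/
theorem summable_exp_mul_exp {t : ℝ} (ht : 0 < t) {S : ℝ} (hS : 0 ≤ S) :
    Summable fun x : ℤ[i] ↦ rexp (-π * t * (x.norm : ℝ)) * rexp (2 * π * S * ‖(x : ℂ)‖) :=
  Summable.of_nonneg_of_le (fun _ ↦ by positivity) (exp_mul_exp_le hS) (summable_expBound ht S)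

/-! ### The theta series `θ_k` -/

/-- The summand `x^k e^{-π t N(x)}` of `θ_k(t)`. [folklore] -/
def thetaTerm (k : ℕ) (t : ℝ) (x : ℤ[i]) : ℂ :=
  (x : ℂ) ^ k * ((rexp (-π * t * (x.norm : ℝ)) : ℝ) : ℂ)

/-- Hecke's theta series of `ℤ[i]` with the harmonic weight `z^k`:
`θ_k(t) = ∑_{x ∈ ℤ[i]} x^k e^{-π t N(x)}` (Hecke 1920, §9). [cite: HeckeMathZ1920, §9] -/
def theta (k : ℕ) (t : ℝ) : ℂ := ∑' x : ℤ[i], thetaTerm k t x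

/-- `‖x^k e^{-π t N(x)}‖ ≤ k! · e^{-π t N(x)} e^{2π (1/(2π)) |x|}` (from `|x|^k/k! ≤ e^{|x|}`).
[folklore] -/
theorem norm_thetaTerm_le (k : ℕ) (t : ℝ) (x : ℤ[i]) :
    ‖thetaTerm k t x‖ ≤
      k ! * (rexp (-π * t * (x.norm : ℝ)) * rexp (2 * π * (1 / (2 * π)) * ‖(x : ℂ)‖)) := by
  rw [thetaTerm, norm_mul, norm_ofReal_exp, norm_pow]
  have h2π : 2 * π * (1 / (2 * π)) * ‖(x : ℂ)‖ = ‖(x : ℂ)‖ := by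
    field_simp
  rw [h2π]
  have hk : (0 : ℝ) < k ! := by exact_mod_cast Nat.factorial_pos k
  have h := Real.pow_div_factorial_le_exp ‖(x : ℂ)‖ (norm_nonneg _) k
  rw [div_le_iff₀ hk] at h
  calc ‖(x : ℂ)‖ ^ k * rexp (-π * t * (x.norm : ℝ))
      ≤ rexp ‖(x : ℂ)‖ * k ! * rexp (-π * t * (x.norm : ℝ)) := by gcongr
    _ = k ! * (rexp (-π * t * (x.norm : ℝ)) * rexp ‖(x : ℂ)‖) := by ring

/-- The theta series converges absolutely for `t > 0`. [folklore] -/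
theorem summable_norm_thetaTerm (k : ℕ) {t : ℝ} (ht : 0 < t) :
    Summable fun x : ℤ[i] ↦ ‖thetaTerm k t x‖ :=
  Summable.of_nonneg_of_le (fun _ ↦ norm_nonneg _) (norm_thetaTerm_le k t)
    ((summable_exp_mul_exp ht (by positivity)).mul_left _)

/-- `θ_k(t) = ∑ x^k e^{-π t N(x)}` (the defining series converges for `t > 0`). [folklore] -/
theorem hasSum_theta (k : ℕ) {t : ℝ} (ht : 0 < t) : HasSum (thetaTerm k t) (theta k t) :=
  (summable_norm_thetaTerm k ht).of_norm.hasSum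

/-! ### The generating function `G_t(w) = ϑ(w, it) ϑ(iw, it)` -/

/-- The generating function `G_t(w) = ∑_{z ∈ ℤ[i]} e^{-π t N(z)} e^{2πi w z}`, DEFINED as the product
`ϑ(w, it) · ϑ(iw, it)` of two Jacobi theta functions (`hasSum_genFun`). [folklore] -/
def genFun (t : ℝ) (w : ℂ) : ℂ := jacobiTheta₂ w (I * t) * jacobiTheta₂ (I * w) (I * t)

/-- The summand of `G_t(w)`: `e^{-π t N(x)} e^{2πi w x}`. [folklore] -/
def genTerm (t : ℝ) (w : ℂ) (x : ℤ[i]) : ℂ :=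
  ((rexp (-π * t * (x.norm : ℝ)) : ℝ) : ℂ) * cexp (2 * π * I * w * (x : ℂ))

/-- The product of the two one-dimensional theta summands is the two-dimensional summand:
`e^{2πi a w - π a² t} · e^{2πi b (iw) - π b² t} = e^{-π t (a² + b²)} e^{2πi w (a + bi)}`. [folklore] -/
theorem jacobiTheta₂_term_mul_jacobiTheta₂_term (a b : ℤ) (t : ℝ) (w : ℂ) :
    jacobiTheta₂_term a w (I * t) * jacobiTheta₂_term b (I * w) (I * t) =
      genTerm t w ⟨a, b⟩ := by
  rw [genTerm, jacobiTheta₂_term, jacobiTheta₂_term, ← Complex.exp_add, Complex.ofReal_exp,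
    ← Complex.exp_add]
  congr 1
  have hn : (((⟨a, b⟩ : ℤ[i]).norm : ℤ) : ℂ) = (a : ℂ) ^ 2 + (b : ℂ) ^ 2 := by
    simp only [Zsqrtd.norm_def]
    push_cast
    ring
  rw [GaussianInt.toComplex_def']
  push_cast
  rw [hn]
  linear_combination ((π : ℂ) * t * ((a : ℂ) ^ 2 + (b : ℂ) ^ 2)) * I_sq

/-- **`G_t(w) = ∑_{z ∈ ℤ[i]} e^{-π t N(z)} e^{2πi w z}`** for `t > 0` (absolutely convergent double
series, product of the two absolutely convergent theta series). [folklore] -/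
theorem hasSum_genFun {t : ℝ} (ht : 0 < t) (w : ℂ) : HasSum (genTerm t w) (genFun t w) := by
  have hτ : 0 < (I * (t : ℂ)).im := by
    rwa [mul_im, I_re, I_im, ofReal_re, ofReal_im, zero_mul, one_mul, zero_add]
  have hA := hasSum_jacobiTheta₂_term w hτ
  have hB := hasSum_jacobiTheta₂_term (I * w) hτ
  -- NB: keep `summable_mul_of_summable_norm` out of expected-type position (unifier vs. `cexp`).
  have h3 := summable_mul_of_summable_norm hA.summable.norm hB.summable.norm
  have hP := hA.mul hB h3
  have hQ : HasSum (genTerm t w ∘ pairEquiv) (genFun t w) := by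
    refine hP.congr_fun fun p ↦ ?_
    exact (jacobiTheta₂_term_mul_jacobiTheta₂_term p.1 p.2 t w).symm
  exact pairEquiv.hasSum_iff.1 hQ

/-- **Jacobi's transformation formula for the generating function**: for `t > 0`,
`G_t(w) = t⁻¹ G_{1/t}(-iw/t)`.  From `ϑ(z, τ) = (-iτ)^{-1/2} e^{-πi z²/τ} ϑ(z/τ, -1/τ)`
(`jacobiTheta₂_functional_equation`) at `τ = it`, `z = w` and `z = iw`: the prefactors are
`t^{-1/2} e^{-π w²/t}` and `t^{-1/2} e^{+π w²/t}`. [folklore] -/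
theorem genFun_functional_equation {t : ℝ} (ht : 0 < t) (w : ℂ) :
    genFun t w = (t : ℂ)⁻¹ * genFun (1 / t) (-I * w / t) := by
  have ht0 : (t : ℂ) ≠ 0 := ofReal_ne_zero.mpr ht.ne'
  have h1 : -I * (I * (t : ℂ)) = t := by
    rw [← mul_assoc, neg_mul, I_mul_I, neg_neg, one_mul]
  set A : ℂ := (t : ℂ) ^ (1 / 2 : ℂ) with hA
  have hAA : A * A = t := by
    rw [hA, ← Complex.cpow_add _ _ ht0]
    norm_num
  have hA0 : A ≠ 0 := by
    rw [hA, Ne, Complex.cpow_eq_zero_iff]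
    exact fun h ↦ ht0 h.1
  have hnI : (-I : ℂ) ≠ 0 := neg_ne_zero.mpr I_ne_zero
  have h2 : w / (I * (t : ℂ)) = -I * w / t := by
    rw [← mul_div_mul_left w (I * (t : ℂ)) hnI, h1]
  have h3 : -1 / (I * (t : ℂ)) = I * (((1 / t : ℝ)) : ℂ) := by
    push_cast
    rw [show (-1 : ℂ) = I * I from I_mul_I.symm, mul_div_mul_left I (t : ℂ) I_ne_zero,
      mul_one_div]
  have h4 : I * w / (I * (t : ℂ)) = I * (-I * w / t) := by
    rw [mul_div_mul_left w (t : ℂ) I_ne_zero, ← mul_div_assoc, ← mul_assoc, mul_neg, I_mul_I,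
      neg_neg, one_mul]
  have h5 : cexp (-π * I * w ^ 2 / (I * t)) * cexp (-π * I * (I * w) ^ 2 / (I * t)) = 1 := by
    rw [← Complex.exp_add, ← add_div,
      show -(π : ℂ) * I * w ^ 2 + -(π : ℂ) * I * (I * w) ^ 2 = 0 by
        rw [mul_pow, I_sq]; ring,
      zero_div, Complex.exp_zero]
  unfold genFun
  rw [jacobiTheta₂_functional_equation w (I * t), jacobiTheta₂_functional_equation (I * w) (I * t),
    h1, ← hA, h2, h3, h4]
  set T1 := jacobiTheta₂ (-I * w / t) (I * (((1 / t : ℝ)) : ℂ))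
  set T2 := jacobiTheta₂ (I * (-I * w / t)) (I * (((1 / t : ℝ)) : ℂ))
  set E1 := cexp (-π * I * w ^ 2 / (I * t))
  set E2 := cexp (-π * I * (I * w) ^ 2 / (I * t))
  calc 1 / A * E1 * T1 * (1 / A * E2 * T2) = (E1 * E2) / (A * A) * (T1 * T2) := by
        field_simp
    _ = (t : ℂ)⁻¹ * (T1 * T2) := by rw [h5, hAA, one_div]

/-! ### `G_t` as an entire power series in `w` -/

/-- The Taylor coefficients of `G_t`: `c_k(t) = ∑_{x ∈ ℤ[i]} e^{-π t N(x)} (2πi x)^k / k!`, so that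
`c_k(t) = (2πi)^k/k! · θ_k(t)` (`coeff_eq_theta`). [folklore] -/
def coeff (t : ℝ) (k : ℕ) : ℂ :=
  ∑' x : ℤ[i], ((rexp (-π * t * (x.norm : ℝ)) : ℝ) : ℂ) * ((2 * π * I * (x : ℂ)) ^ k / k !)

/-- The double family `e^{-π t N(x)} (2πi w x)^k / k!` on `ℤ[i] × ℕ`. [folklore] -/
def dblTerm (t : ℝ) (w : ℂ) (p : ℤ[i] × ℕ) : ℂ :=
  ((rexp (-π * t * (p.1.norm : ℝ)) : ℝ) : ℂ) * ((2 * π * I * w * (p.1 : ℂ)) ^ p.2 / p.2 !)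

/-- The nonnegative majorant `e^{-π t N(x)} (2π R |x|)^k / k!` of the double family is summable on
`ℤ[i] × ℕ` for `t > 0` (sum over `k` first: `e^{-π t N(x)} e^{2π R |x|}`). [folklore] -/
theorem summable_majorant {t : ℝ} (ht : 0 < t) {R : ℝ} (hR : 0 ≤ R) :
    Summable fun p : ℤ[i] × ℕ ↦
      rexp (-π * t * (p.1.norm : ℝ)) * ((2 * π * R * ‖(p.1 : ℂ)‖) ^ p.2 / p.2 !) := by
  refine (summable_prod_of_nonneg fun p ↦ by positivity).2 ⟨fun x ↦ ?_, ?_⟩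
  · show Summable fun k : ℕ ↦ rexp (-π * t * (x.norm : ℝ)) * ((2 * π * R * ‖(x : ℂ)‖) ^ k / k !)
    exact (Real.summable_pow_div_factorial _).mul_left _
  · have h : ∀ x : ℤ[i], ∑' k : ℕ, rexp (-π * t * (x.norm : ℝ)) *
        ((2 * π * R * ‖(x : ℂ)‖) ^ k / k !) =
        rexp (-π * t * (x.norm : ℝ)) * rexp (2 * π * R * ‖(x : ℂ)‖) := fun x ↦ by
      rw [tsum_mul_left]
      congr 1
      rw [Real.exp_eq_exp_ℝ]
      exact (NormedSpace.expSeries_div_hasSum_exp _).tsum_eq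
    simp_rw [h]
    exact summable_exp_mul_exp ht hR

/-- `‖e^{-π t N(x)} (2πi w x)^k / k!‖ = e^{-π t N(x)} (2π |w| |x|)^k / k!`. [folklore] -/
theorem norm_dblTerm (t : ℝ) (w : ℂ) (p : ℤ[i] × ℕ) :
    ‖dblTerm t w p‖ = rexp (-π * t * (p.1.norm : ℝ)) * ((2 * π * ‖w‖ * ‖(p.1 : ℂ)‖) ^ p.2 / p.2 !) := by
  rw [dblTerm, norm_mul, norm_ofReal_exp, norm_div, norm_pow, Complex.norm_natCast, norm_mul,
    norm_mul, norm_mul, norm_mul, Complex.norm_two, Complex.norm_real, Real.norm_of_nonneg pi_pos.le,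
    Complex.norm_I, mul_one]

/-- The double family is absolutely summable for `t > 0`. [folklore] -/
theorem summable_dblTerm {t : ℝ} (ht : 0 < t) (w : ℂ) : Summable (dblTerm t w) :=
  Summable.of_norm_bounded (summable_majorant ht (norm_nonneg w)) fun p ↦ (norm_dblTerm t w p).le

/-- Summing the double family over `k` first: `∑_k e^{-π t N(x)} (2πi w x)^k/k! = e^{-π t N(x)}
e^{2πi w x}`. [folklore] -/
theorem hasSum_dblTerm_fst (t : ℝ) (w : ℂ) (x : ℤ[i]) :
    HasSum (fun k : ℕ ↦ dblTerm t w (x, k)) (genTerm t w x) := by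
  have h : HasSum (fun k : ℕ ↦ (2 * π * I * w * (x : ℂ)) ^ k / k !)
      (cexp (2 * π * I * w * (x : ℂ))) := by
    rw [Complex.exp_eq_exp_ℂ]
    exact NormedSpace.expSeries_div_hasSum_exp _
  exact h.mul_left _

/-- Summing the double family over `x` first: `∑_x e^{-π t N(x)} (2πi w x)^k/k! = c_k(t) w^k`.
[folklore] -/
theorem hasSum_dblTerm_snd {t : ℝ} (ht : 0 < t) (w : ℂ) (k : ℕ) :
    HasSum (fun x : ℤ[i] ↦ dblTerm t w (x, k)) (coeff t k * w ^ k) := by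
  have hs : Summable fun x : ℤ[i] ↦ dblTerm t w (x, k) :=
    (summable_dblTerm ht w).prod_symm.prod_factor k
  have heq : (fun x : ℤ[i] ↦ dblTerm t w (x, k)) = fun x : ℤ[i] ↦
      (((rexp (-π * t * (x.norm : ℝ)) : ℝ) : ℂ) * ((2 * π * I * (x : ℂ)) ^ k / k !)) * w ^ k := by
    funext x
    simp only [dblTerm]
    ring
  rw [heq] at hs ⊢
  rw [coeff, ← tsum_mul_right]
  exact hs.hasSum

/-- **The Taylor expansion of `G_t`**: `G_t(w) = ∑_k c_k(t) w^k` for every `w` (`t > 0`).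
[folklore] -/
theorem hasSum_coeff_mul_pow {t : ℝ} (ht : 0 < t) (w : ℂ) :
    HasSum (fun k : ℕ ↦ coeff t k * w ^ k) (genFun t w) := by
  have hT := (summable_dblTerm ht w).hasSum
  have h1 : HasSum (genTerm t w) (∑' p, dblTerm t w p) :=
    hT.prod_fiberwise fun x ↦ hasSum_dblTerm_fst t w x
  have h2 : HasSum (fun k : ℕ ↦ coeff t k * w ^ k) (∑' p, dblTerm t w p) :=
    ((Equiv.prodComm ℕ ℤ[i]).hasSum_iff.2 hT).prod_fiberwise fun k ↦ hasSum_dblTerm_snd ht w k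
  rwa [h1.unique (hasSum_genFun ht w)] at h2

/-- `‖c_k(t)‖ r^k ≤ ∑_x e^{-π t N(x)} (2π r |x|)^k / k!`. [folklore] -/
theorem norm_coeff_mul_pow_le {t : ℝ} (ht : 0 < t) {r : ℝ} (hr : 0 ≤ r) (k : ℕ) :
    ‖coeff t k‖ * r ^ k ≤
      ∑' x : ℤ[i], rexp (-π * t * (x.norm : ℝ)) * ((2 * π * r * ‖(x : ℂ)‖) ^ k / k !) := by
  have hs : Summable fun x : ℤ[i] ↦
      rexp (-π * t * (x.norm : ℝ)) * ((2 * π * r * ‖(x : ℂ)‖) ^ k / k !) :=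
    (summable_majorant ht hr).prod_symm.prod_factor k
  have h1 : ‖coeff t k‖ * r ^ k = ‖coeff t k * (r : ℂ) ^ k‖ := by
    rw [norm_mul, norm_pow, Complex.norm_real, Real.norm_of_nonneg hr]
  rw [h1, ← (hasSum_dblTerm_snd ht (r : ℂ) k).tsum_eq]
  refine tsum_of_norm_bounded hs.hasSum fun x ↦ ?_
  rw [norm_dblTerm, Complex.norm_real, Real.norm_of_nonneg hr]

/-- The power series `∑ c_k(t) w^k` has infinite radius of convergence. [folklore] -/
theorem radius_ofScalars_coeff {t : ℝ} (ht : 0 < t) :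
    (FormalMultilinearSeries.ofScalars ℂ (coeff t)).radius = ⊤ := by
  refine FormalMultilinearSeries.radius_eq_top_of_summable_norm _ fun r ↦ ?_
  simp_rw [FormalMultilinearSeries.ofScalars_norm]
  refine Summable.of_nonneg_of_le (fun k ↦ by positivity)
    (fun k ↦ norm_coeff_mul_pow_le ht r.coe_nonneg k) ?_
  exact (summable_majorant ht r.coe_nonneg).prod_symm.prod

/-- **`G_t` is an entire power series with coefficients `c_k(t)`.** [folklore] -/
theorem hasFPowerSeriesOnBall_genFun {t : ℝ} (ht : 0 < t) :
    HasFPowerSeriesOnBall (genFun t) (FormalMultilinearSeries.ofScalars ℂ (coeff t)) 0 ⊤ := by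
  refine ⟨(radius_ofScalars_coeff ht).ge, ENNReal.zero_lt_top, fun {w} _ ↦ ?_⟩
  simp_rw [FormalMultilinearSeries.ofScalars_apply_eq, smul_eq_mul, zero_add]
  exact hasSum_coeff_mul_pow ht w

/-- The transformed side `w ↦ t⁻¹ G_{1/t}(-iw/t)` is the power series with coefficients
`t⁻¹ c_k(1/t) (-i/t)^k`. [folklore] -/
theorem hasFPowerSeriesOnBall_genFun_transformed {t : ℝ} (ht : 0 < t) :
    HasFPowerSeriesOnBall (fun w : ℂ ↦ (t : ℂ)⁻¹ * genFun (1 / t) (-I * w / t))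
      (FormalMultilinearSeries.ofScalars ℂ
        (fun k ↦ (t : ℂ)⁻¹ * coeff (1 / t) k * (-I / t) ^ k)) 0 ⊤ := by
  have ht' : 0 < 1 / t := one_div_pos.mpr ht
  have hrad : (FormalMultilinearSeries.ofScalars ℂ
      (fun k ↦ (t : ℂ)⁻¹ * coeff (1 / t) k * (-I / t) ^ k)).radius = ⊤ := by
    refine FormalMultilinearSeries.radius_eq_top_of_summable_norm _ fun r ↦ ?_
    simp_rw [FormalMultilinearSeries.ofScalars_norm]
    have hr' : 0 ≤ (r : ℝ) / t := div_nonneg r.coe_nonneg ht.le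
    have hmaj := ((summable_majorant ht' hr').prod_symm.prod).mul_left ‖(t : ℂ)⁻¹‖
    refine Summable.of_nonneg_of_le (fun k ↦ by positivity) (fun k ↦ ?_) hmaj
    have hnI : ‖(-I / t : ℂ)‖ = 1 / t := by
      rw [norm_div, norm_neg, Complex.norm_I, Complex.norm_real, Real.norm_of_nonneg ht.le]
    calc ‖(t : ℂ)⁻¹ * coeff (1 / t) k * (-I / t) ^ k‖ * (r : ℝ) ^ k
        = ‖(t : ℂ)⁻¹‖ * (‖coeff (1 / t) k‖ * ((r : ℝ) / t) ^ k) := by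
          rw [norm_mul, norm_mul, norm_pow, hnI, div_pow, div_pow, one_pow]
          ring
      _ ≤ ‖(t : ℂ)⁻¹‖ * ∑' x : ℤ[i], rexp (-π * (1 / t) * (x.norm : ℝ)) *
            ((2 * π * ((r : ℝ) / t) * ‖(x : ℂ)‖) ^ k / k !) := by
          gcongr
          exact norm_coeff_mul_pow_le ht' hr' k
  refine ⟨hrad.ge, ENNReal.zero_lt_top, fun {w} _ ↦ ?_⟩
  simp_rw [FormalMultilinearSeries.ofScalars_apply_eq, smul_eq_mul, zero_add]
  have h := (hasSum_coeff_mul_pow ht' (-I * w / t)).mul_left (t : ℂ)⁻¹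
  refine h.congr_fun fun k ↦ ?_
  rw [show -I * w / (t : ℂ) = (-I / t) * w by ring, mul_pow]
  ring

/-- **Equality of Taylor coefficients**: `c_k(t) = t⁻¹ (-i/t)^k c_k(1/t)` for `t > 0`
(uniqueness of power-series expansions applied to `genFun_functional_equation`). [folklore] -/
theorem coeff_functional_equation {t : ℝ} (ht : 0 < t) (k : ℕ) :
    coeff t k = (t : ℂ)⁻¹ * coeff (1 / t) k * (-I / t) ^ k := by
  have h1 := (hasFPowerSeriesOnBall_genFun ht).hasFPowerSeriesAt
  have h2 := (hasFPowerSeriesOnBall_genFun_transformed ht).hasFPowerSeriesAt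
  have heq : ∀ᶠ w in 𝓝 (0 : ℂ), genFun t w = (t : ℂ)⁻¹ * genFun (1 / t) (-I * w / t) :=
    Eventually.of_forall fun w ↦ genFun_functional_equation ht w
  have h := h1.eq_formalMultilinearSeries_of_eventually h2 heq
  rw [FormalMultilinearSeries.ofScalars_series_eq_iff] at h
  exact congrFun h k

/-! ### The transformation formula for `θ_k` -/

/-- `c_k(t) = (2πi)^k / k! · θ_k(t)`. [folklore] -/
theorem coeff_eq_theta (k : ℕ) {t : ℝ} (ht : 0 < t) :
    coeff t k = (2 * π * I) ^ k / k ! * theta k t := by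
  rw [coeff, ← (hasSum_theta k ht).tsum_eq, ← tsum_mul_left]
  congr 1
  funext x
  rw [thetaTerm, mul_pow]
  ring

/-- **Theta transformation formula** (Hecke 1920, §9, for `ℚ(i)` and the weights `z^k`):
`θ_k(1/t) = i^k t^{k+1} θ_k(t)` for `t > 0`. [cite: HeckeMathZ1920, §9] -/
theorem theta_one_div (k : ℕ) {t : ℝ} (ht : 0 < t) :
    theta k (1 / t) = I ^ k * (t : ℂ) ^ (k + 1) * theta k t := by
  have ht' : 0 < 1 / t := one_div_pos.mpr ht
  have ht0 : (t : ℂ) ≠ 0 := ofReal_ne_zero.mpr ht.ne'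
  have hc : ((2 * π * I) ^ k / k ! : ℂ) ≠ 0 := by
    refine div_ne_zero (pow_ne_zero _ ?_) (by exact_mod_cast (Nat.factorial_pos k).ne')
    exact mul_ne_zero (mul_ne_zero two_ne_zero (ofReal_ne_zero.mpr pi_pos.ne')) I_ne_zero
  have h := coeff_functional_equation ht k
  rw [coeff_eq_theta k ht, coeff_eq_theta k ht'] at h
  -- `h : C θ_k(t) = t⁻¹ (C θ_k(1/t)) (-i/t)^k`; solve for `θ_k(t)`
  have key : theta k t = (t : ℂ)⁻¹ * (-I / t) ^ k * theta k (1 / t) :=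
    mul_left_cancel₀ hc (h.trans (by ring))
  have hI1 : I * (-I / (t : ℂ)) * t = 1 := by
    rw [mul_div_assoc', div_mul_cancel₀ _ ht0, mul_neg, I_mul_I, neg_neg]
  have hone : I ^ k * (t : ℂ) ^ (k + 1) * ((t : ℂ)⁻¹ * (-I / t) ^ k) = 1 := by
    calc I ^ k * (t : ℂ) ^ (k + 1) * ((t : ℂ)⁻¹ * (-I / t) ^ k)
        = (I * (-I / (t : ℂ)) * t) ^ k * ((t : ℂ) * (t : ℂ)⁻¹) := by ring
      _ = 1 := by rw [hI1, one_pow, one_mul, mul_inv_cancel₀ ht0]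
  calc theta k (1 / t)
      = (I ^ k * (t : ℂ) ^ (k + 1) * ((t : ℂ)⁻¹ * (-I / t) ^ k)) * theta k (1 / t) := by
        rw [hone, one_mul]
    _ = I ^ k * (t : ℂ) ^ (k + 1) * theta k t := by rw [key]; ring

/-- The case `k = 4m`: `θ_{4m}(1/t) = t^{4m+1} θ_{4m}(t)` (`i^{4m} = 1`) — the functional equation
of weight `4m + 1` and root number `1` of the theta series of the Hecke character `λ^m` of `ℤ[i]`.
[cite: HeckeMathZ1920, §9] -/
theorem theta_four_mul_one_div (m : ℕ) {t : ℝ} (ht : 0 < t) :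
    theta (4 * m) (1 / t) = (t : ℂ) ^ (4 * m + 1) * theta (4 * m) t := by
  rw [theta_one_div (4 * m) ht, pow_mul, I_pow_four, one_pow, one_mul]

end GaussianHecke

end Literature.NumberTheory.LFunctions
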